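import Summits.CriticalPhenomena.PercolationContinuityZ3.Theorems.Transplant.SiteVdBHKCore
import HarnessLib

/-!
# SITE percolation: the open cluster is conditionally positively associated given `{s ↮ X}` — III: site Theorem 1.3

Part III of three: `SiteBHK.siteClusterCondPosAssoc` and the connection-events corollary (imports Part II `SiteVdBHKCore`).


builds on p205010 (kernel theorem, internal audit signed; external expert review pending).

van den Berg–Häggström–Kahn (Random Structures Algorithms 29 (2006), Thms 1.1–1.3) prove, for
BOND percolation, that the open cluster `C_s` is positively associated conditionally on
`R_X = {s ↮ X}`; the tree proves it in `ConditionalPositiveAssociationProofs.lean`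
(`BHK2006.core`, `BHK2006_clusterConditionalPositiveAssociation_holds`).  The printed theorem does
NOT cover site percolation ("Consider ordinary bond percolation", §1 p. 3), and site percolation is
not a special case of bond percolation; the p205010 chain uses Thm 1.3 at its links (B0) and (C2)
(CHAIN-READ §3.7, §4.4), so a site re-run of the chain needs the SITE theorem.  This file proves it
(OUR theorem; the census seat's sketch `run/shared/lean/prim/bschramm/CENSUS.md` §7b):

**Setting (convention A).** `V` finite, `Γ : SimpleGraph V`, vertex weights `q : V → [0,1]`, law
`prodBernoulli q` on `Set V` (the open vertices); `u ↔ v` iff `u, v` are open and joined by a path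
of open vertices; `C_s = siteCluster Γ ω s` (`= ∅` if `s` is closed); `R_X = {∀ x ∈ X, x ∉ C_s}`
(so `s ∈ X` is allowed and then `R_X = {s closed}`).

* `SiteBHK.core` — **site Thm 1.1, functional form**, for percolation restricted to a vertex set
  `U`: for `F, G ≥ 0` increasing,
  `E[F(C) 1_{R_X}] E[G(C) 1_{R_Y}] ≤ E[F(C) G(C) 1_{R_{X∩Y}}] P(R_{X∪Y})`.
  PROOF = BHK's induction on the vertex set with ONE substitution: instead of conditioning on the
  set of vertices joined to `Z = X ∩ Y` by an open EDGE, condition on the STATES OF THE VERTICES OF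
  `Z` (a block of coordinates of `ω : Set V`, product law — `BHK2006.blockFubini`); given them, with
  `S` = the open vertices of `Z` and `N(S)` = their neighbours in `U ∖ Z`,
  `{s ↮ W in U} = {s ↮ (W ∖ Z) ∪ N(S) in U ∖ Z}` for `W ⊇ Z` and on this event the cluster of `s`
  in `U` is its cluster in `U ∖ Z` (`SiteBHK.mem_sD_iff_restrict`, `SiteBHK.sC_restrict`: a path
  from `s` first enters `Z` at an OPEN vertex, from a neighbour reached inside `U ∖ Z`; closed
  vertices of `Z` block).  `N(S ∩ T) ⊆ N(S) ∩ N(T)`, `N(S ∪ T) = N(S) ∪ N(T)`, and the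
  Ahlswede–Daykin step is verbatim (`four_functions_theorem_univ` with the product-weight lattice
  identity × the induction hypothesis).  `Z = ∅` is Harris twice; the degenerate placements
  `s ∈ X` / `s ∈ Y` (where `R = {s closed}` and `C = ∅`) hold pointwise.
* `SiteBHK.siteClusterCondPosAssoc` — **site Thm 1.3**: for `F, G` monotone functions of the site
  cluster, `(∫_{R_X} F(C_s))(∫_{R_X} G(C_s)) ≤ P(R_X) ∫_{R_X} F(C_s) G(C_s)` under `prodBernoulli q`
  (denominator-free, exactly the shape of the bond fact `BHK2006_clusterConditionalPositiveAssociation`,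
  with NO hypothesis `s ∉ X`).

Exact census (census seat, CENSUS.md §4, rows BHK13/VDBK*): 0 violations on n ≤ 5 exhaustive
(9.8 M instances) before this proof was written.  Support file (`--supports stmt-CriticalPhenomena-4575
--as helper`); sorry-free, standard axioms; no new `Prop` definitions.
[cite: VandenbergHaggstromKahn2005, Thms. 1.1–1.3 (pp. 3–6)] [cite: GrimmettPercolation1999, §1.6 p. 24]
-/

noncomputable section

namespace Summit.CriticalPhenomena.PercolationContinuityZ3.Theorems.Transplant

namespace SiteBHK

open MeasureTheory unitInterval
open Literature.Probability.LatticeModels (prodBernoulli)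
open Literature.Probability.Percolation
open Literature.Probability.Percolation.BHK2006 (weight weight_nonneg weight_inter_mul_union blockFubini
  sum_affine harris harris_mono_anti harris_anti_anti sum_ind_mono sum_ind_nonneg
  integral_prodBernoulli_eq_sum ind_le_one ind_mono ind_inter)
open scoped Classical
open DecisionTree (ind ind_of_mem ind_of_not_mem ind_nonneg)

variable {V : Type*} (Γ : SimpleGraph V)

variable {Γ}
variable [Fintype V]

/-! ### Site Theorem 1.3: conditional positive association of the site cluster under `prodBernoulli q` -/

omit [Fintype V] in
/-- With `U = univ` the restricted site cluster is the tree's `siteCluster`. [folklore] -/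
theorem sC_univ [Fintype V] (s : V) (ω : Set V) : sC Γ Finset.univ s ω = siteCluster Γ ω s := by
  have hE : ω ∩ (↑(Finset.univ : Finset V) : Set V) = ω := by simp
  ext y
  simp only [sC, hE, siteCluster, Set.mem_setOf_eq]

/-- **Site van den Berg–Häggström–Kahn Theorem 1.3 (OURS; the printed theorem is bond-only).**
For site percolation with arbitrary vertex weights `q` on a finite graph `Γ` (law `prodBernoulli q`
on the set of open vertices), every vertex `s`, every `X ⊆ V` (the case `s ∈ X` included, where
`{s ↮ X} = {s closed}`), and monotone functions `F, G` of the open site cluster `C_s`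
(`siteCluster`, empty when `s` is closed):
`(∫_{s↮X} F(C_s)) (∫_{s↮X} G(C_s)) ≤ P(s ↮ X) ∫_{s↮X} F(C_s) G(C_s)` — i.e. given `{s ↮ X}` the site
cluster of `s` is positively associated.  Same shape as the bond fact
`BHK2006_clusterConditionalPositiveAssociation`; proof = `SiteBHK.core` at `U = univ`, `Y = X`, with
`F, G` shifted by `F ∅, G ∅`. [cite: VandenbergHaggstromKahn2005, Thm. 1.3 (p. 6)] -/
theorem siteClusterCondPosAssoc (q : V → unitInterval) (s : V) (X : Set V) (F G : Set V → ℝ)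
    (hF : Monotone F) (hG : Monotone G) :
    (∫ ω in {ω | ∀ x ∈ X, x ∉ siteCluster Γ ω s}, F (siteCluster Γ ω s) ∂(prodBernoulli q)) *
      (∫ ω in {ω | ∀ x ∈ X, x ∉ siteCluster Γ ω s}, G (siteCluster Γ ω s) ∂(prodBernoulli q)) ≤
    (prodBernoulli q).real {ω | ∀ x ∈ X, x ∉ siteCluster Γ ω s} *
      ∫ ω in {ω | ∀ x ∈ X, x ∉ siteCluster Γ ω s},
        F (siteCluster Γ ω s) * G (siteCluster Γ ω s) ∂(prodBernoulli q) := by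
  set D : Set (Set V) := {ω | ∀ x ∈ X, x ∉ siteCluster Γ ω s} with hD
  have hDm : MeasurableSet D := MeasurableSet.of_discrete
  set q' : V → ℝ := fun v => (q v : ℝ) with hq'
  have hq0 : ∀ v, 0 ≤ q' v := fun v => (q v).2.1
  have hq1 : ∀ v, q' v ≤ 1 := fun v => (q v).2.2
  have hint : ∀ h : Set V → ℝ,
      ∫ ω in D, h ω ∂(prodBernoulli q) = ∑ ω, weight q' ω * (h ω * ind D ω) := by
    intro h
    rw [← integral_indicator hDm, integral_prodBernoulli_eq_sum]
    refine Finset.sum_congr rfl fun ω _ => ?_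
    by_cases hω : ω ∈ D
    · rw [Set.indicator_of_mem hω, ind_of_mem hω, mul_one]
    · rw [Set.indicator_of_notMem hω, ind_of_not_mem hω]; ring
  have hreal : (prodBernoulli q).real D = ∑ ω, weight q' ω * ind D ω := by
    rw [← integral_indicator_one hDm, integral_prodBernoulli_eq_sum]
    refine Finset.sum_congr rfl fun ω _ => ?_
    by_cases hω : ω ∈ D
    · rw [Set.indicator_of_mem hω, ind_of_mem hω, Pi.one_apply]
    · rw [Set.indicator_of_notMem hω, ind_of_not_mem hω, mul_zero]
  have hm : ∑ ω, weight q' ω = 1 := by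
    have h1 := integral_prodBernoulli_eq_sum q fun _ => (1 : ℝ)
    simp only [integral_const, probReal_univ, smul_eq_mul, mul_one] at h1
    exact h1.symm
  have hC : ∀ ω, sC Γ Finset.univ s ω = siteCluster Γ ω s := sC_univ s
  have hDD : sD Γ Finset.univ s X = D := by
    ext ω
    simp only [sD, hC, hD, Set.mem_setOf_eq]
  have hXU : X ⊆ ↑(Finset.univ : Finset V) := by simp
  have key := core (Γ := Γ) q' hq0 hq1 hm Finset.univ s (Finset.mem_univ s) X X hXU hXU
    (fun a => F a - F ∅) (fun a => G a - G ∅)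
    (fun a b hab => sub_le_sub_right (hF hab) _) (fun a b hab => sub_le_sub_right (hG hab) _)
    (fun a => sub_nonneg.2 (hF (Set.empty_subset a)))
    (fun a => sub_nonneg.2 (hG (Set.empty_subset a)))
  rw [Set.inter_self, Set.union_self] at key
  simp only [hC, hDD] at key
  set P := ∑ ω, weight q' ω * ind D ω with hP
  set Ef := ∑ ω, weight q' ω * (F (siteCluster Γ ω s) * ind D ω) with hEf
  set Eg := ∑ ω, weight q' ω * (G (siteCluster Γ ω s) * ind D ω) with hEg
  set Efg := ∑ ω, weight q' ω * (F (siteCluster Γ ω s) * G (siteCluster Γ ω s) * ind D ω) with hEfg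
  have x1 : ∑ ω, weight q' ω * ((F (siteCluster Γ ω s) - F ∅) * ind D ω) = Ef - F ∅ * P := by
    have := sum_affine q' (fun ω => (F (siteCluster Γ ω s) - F ∅) * ind D ω)
      (fun ω => F (siteCluster Γ ω s) * ind D ω) (ind D) (ind D) (ind D) 1 (-F ∅) 0 0
      (fun ω => by ring)
    rw [this]; ring
  have x2 : ∑ ω, weight q' ω * ((G (siteCluster Γ ω s) - G ∅) * ind D ω) = Eg - G ∅ * P := by
    have := sum_affine q' (fun ω => (G (siteCluster Γ ω s) - G ∅) * ind D ω)
      (fun ω => G (siteCluster Γ ω s) * ind D ω) (ind D) (ind D) (ind D) 1 (-G ∅) 0 0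
      (fun ω => by ring)
    rw [this]; ring
  have x3 : ∑ ω, weight q' ω * ((F (siteCluster Γ ω s) - F ∅) * (G (siteCluster Γ ω s) - G ∅)
      * ind D ω) = Efg - F ∅ * Eg - G ∅ * Ef + F ∅ * G ∅ * P := by
    have := sum_affine q'
      (fun ω => (F (siteCluster Γ ω s) - F ∅) * (G (siteCluster Γ ω s) - G ∅) * ind D ω)
      (fun ω => F (siteCluster Γ ω s) * G (siteCluster Γ ω s) * ind D ω)
      (fun ω => G (siteCluster Γ ω s) * ind D ω) (fun ω => F (siteCluster Γ ω s) * ind D ω)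
      (ind D) 1 (-F ∅) (-G ∅) (F ∅ * G ∅) (fun ω => by ring)
    rw [this]; ring
  rw [x1, x2, x3] at key
  rw [hint, hint, hint (fun ω => F (siteCluster Γ ω s) * G (siteCluster Γ ω s)), hreal]
  show Ef * Eg ≤ P * Efg
  nlinarith [key]

/-- **Site van den Berg–Kahn (2001) Thm 1.2 / vdBHK Thm 1.2**, the connection-events case: given
`{s ↮ X}`, the events `{a ∈ C_s}` and `{b ∈ C_s}` are positively correlated (site model, convention A):
`P(s↮X, s↔a) P(s↮X, s↔b) ≤ P(s↮X) P(s↮X, s↔a, s↔b)`.  The instance `F = 1{a ∈ ·}`, `G = 1{b ∈ ·}` of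
`siteClusterCondPosAssoc`. [cite: VandenbergHaggstromKahn2005, Thm. 1.2 (p. 5) and eq. (1) (p. 3)] -/
theorem siteConn_condPosCorr (q : V → unitInterval) (s a b : V) (X : Set V) :
    (prodBernoulli q).real ({ω | ∀ x ∈ X, x ∉ siteCluster Γ ω s} ∩ {ω | a ∈ siteCluster Γ ω s}) *
      (prodBernoulli q).real ({ω | ∀ x ∈ X, x ∉ siteCluster Γ ω s} ∩ {ω | b ∈ siteCluster Γ ω s}) ≤
    (prodBernoulli q).real {ω | ∀ x ∈ X, x ∉ siteCluster Γ ω s} *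
      (prodBernoulli q).real ({ω | ∀ x ∈ X, x ∉ siteCluster Γ ω s} ∩
        ({ω | a ∈ siteCluster Γ ω s} ∩ {ω | b ∈ siteCluster Γ ω s})) := by
  classical
  have hmeas : ∀ S : Set (Set V), MeasurableSet S := fun _ => MeasurableSet.of_discrete
  set D : Set (Set V) := {ω | ∀ x ∈ X, x ∉ siteCluster Γ ω s} with hD
  have hmono : ∀ c : V, Monotone fun C : Set V => (Set.indicator {C : Set V | c ∈ C} 1 C : ℝ) := by
    intro c C C' h
    by_cases h1 : c ∈ C
    · have h2 : c ∈ C' := h h1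
      simp [h1, h2]
    · simp only [Set.indicator, Set.mem_setOf_eq, h1, if_false]
      split_ifs <;> norm_num
  have key := siteClusterCondPosAssoc (Γ := Γ) q s X (fun C => (Set.indicator {C | a ∈ C} 1 C : ℝ))
    (fun C => (Set.indicator {C | b ∈ C} 1 C : ℝ)) (hmono a) (hmono b)
  have hA : ∫ ω in D, (Set.indicator {C : Set V | a ∈ C} 1 (siteCluster Γ ω s) : ℝ) ∂(prodBernoulli q) =
      (prodBernoulli q).real (D ∩ {ω | a ∈ siteCluster Γ ω s}) := by
    rw [← integral_indicator_one ((hmeas D).inter (hmeas _)), ← integral_indicator (hmeas D)]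
    congr 1; funext ω
    by_cases h1 : ω ∈ D <;> by_cases h2 : a ∈ siteCluster Γ ω s <;> simp [h1, h2]
  have hB : ∫ ω in D, (Set.indicator {C : Set V | b ∈ C} 1 (siteCluster Γ ω s) : ℝ) ∂(prodBernoulli q) =
      (prodBernoulli q).real (D ∩ {ω | b ∈ siteCluster Γ ω s}) := by
    rw [← integral_indicator_one ((hmeas D).inter (hmeas _)), ← integral_indicator (hmeas D)]
    congr 1; funext ω
    by_cases h1 : ω ∈ D <;> by_cases h2 : b ∈ siteCluster Γ ω s <;> simp [h1, h2]
  have hAB : ∫ ω in D, (Set.indicator {C : Set V | a ∈ C} 1 (siteCluster Γ ω s) : ℝ) *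
      (Set.indicator {C : Set V | b ∈ C} 1 (siteCluster Γ ω s) : ℝ) ∂(prodBernoulli q) =
      (prodBernoulli q).real (D ∩ ({ω | a ∈ siteCluster Γ ω s} ∩ {ω | b ∈ siteCluster Γ ω s})) := by
    rw [← integral_indicator_one ((hmeas D).inter ((hmeas _).inter (hmeas _))),
      ← integral_indicator (hmeas D)]
    congr 1; funext ω
    by_cases h1 : ω ∈ D <;> by_cases h2 : a ∈ siteCluster Γ ω s <;>
      by_cases h3 : b ∈ siteCluster Γ ω s <;> simp [h1, h2, h3]
  rw [hA, hB, hAB] at key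
  exact key

end SiteBHK

end Summit.CriticalPhenomena.PercolationContinuityZ3.Theorems.Transplant
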